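import Literature.Analysis.FluidPDE.SingularKernelHolder
import Literature.Analysis.FluidPDE.BiotSavartGradient
import Literature.Analysis.FluidPDE.NewtonKernelLogPotential
import HarnessLib

/-!
# The logarithmic sup-norm estimate for the gradient of singular potentials of Hölder densities
(Majda–Bertozzi Lemma 4.6 (4.35), (4.49)–(4.50))

Topic `Literature/Analysis/FluidPDE`. Fourth part of the regularity theory of
`SingularKernelTruncation.lean` / `SingularKernelGradient.lean` / `SingularKernelHolder.lean`, on
the discharge path of the named fact
`Literature.Analysis.FluidPDE.MajdaBertozzi2002_particleTrajectoryAprioriBound`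
(`HolderEulerContinuationProofs.lean`; Majda–Bertozzi, *Vorticity and Incompressible Flow*,
CUP 2002, §4.2 Thm 4.3 (i), the Beale–Kato–Majda criterion for particle trajectories). The
closing step of the printed proof (p. 134–135 of the held text) is the potential-theory
estimate **(4.35)** of **Lemma 4.6** (p. 129): "`|P_N f|_0 ≤ c{|f|_γ ε^γ + max(1, ln(R/ε))|f|_0}`,
`∀ ε > 0`", applied through **(4.49)** "`∇v(x,t) = PV ∫ P_N(x − x′) ω(x′,t) dx′ + cω(x,t)`" to get
**(4.50)** "`|∇v(·, t)|_0 ≤ |ω(·, t)|_0 [|log(R|ω(·,t)|_γ)| + C]`" — the logarithm that makes the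
Grönwall inequality for `∫₀ᵗ |∇v|₀` close linearly.

This file proves (4.35) for the gradient `∇v = ∇ ∫ K(· − y) f(y) dy` of the singular potential of
a kernel `K` of degree `−2` (`IsC1SingularKernel K A`: `‖K z‖ ≤ A|z|⁻²`, `‖∇K z‖ ≤ A|z|⁻³`) and a
`γ`-Hölder density `f` (constant `C`, `|f| ≤ M`, `supp f ⊆ B̄(x₀, R)`), in the sphere-free form
of the tree: by `fderiv_singularPotential` (`SingularKernelGradient.lean`, Gilbarg–Trudinger
(4.9) with a smooth cutoff `χ`), for `x ∈ B(x₀, ρ/2)`,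
`∇v(x) = ∫ (∇K(x−y)·)(f y − χ(y) f x) dy + ∫ ∇χ(y) ⊗ K(x−y) f(x) dy`; the second term is
`O(A B M)` (`norm_integral_cutoffTerm_le`, `SingularKernelHolder.lean`), and the first is split at
`|x − y| = ε ≤ ρ/2`: on `|x − y| < ε` the cutoff is `1` and the Hölder bound
`A C |x − y|^{γ−3}` integrates to `A C 4π ε^γ/γ` (`holderMajorant`), while on
`ε ≤ |x − y| < 3ρ` the crude bound `2 A M |x − y|⁻³` integrates to `2 A M · 4π log(3ρ/ε)`
(the tree's annulus integral `lintegral_annulus_norm_rpow_neg_three`,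
`NewtonKernelLogPotential.lean`). With `ρ = 4R` near the support and the far-field bound
`norm_fderiv_singularPotential_le_far` elsewhere this gives, for `0 < ε ≤ R` and all `x`,

  `‖∇v(x)‖ ≤ A C 4π ε^γ/γ + 8π A M (log(R/ε) + log 12) + (4π/3) A M + (128π/3) A B M`

(`norm_fderiv_singularPotential_le_log`), and for the Biot–Savart law the packaged form
`exists_norm_fderiv_biotSavart_le_log`: `‖∇(K₃ ∗ ω)(x)‖ ≤ c(γ) (C ε^γ + M (1 + log(R/ε)))`.

## Contents (all proved)

* `logMajorant ε ρ'` (`= 1_{ε ≤ |z| < ρ'} |z|⁻³`), `lintegral_logMajorant` (`= 4π log(ρ'/ε)`);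
* `norm_gradIntegrand_le_log` (pointwise two-zone majorant), `norm_integral_gradIntegrand_le_log`,
  `norm_gradPotential_le_log` (local, `x ∈ B(x₀, ρ/2)`, `0 < ε ≤ ρ/2`);
* `norm_fderiv_singularPotential_le_log` (global), `exists_norm_fderiv_biotSavart_le_log`.

## Mathlib / tree search

No logarithmic `L^∞` bound for `∇(K ∗ f)` with `f ∈ C^γ` in Mathlib. Tree: the `C^∞`,
`γ = 1/2`, energy-far-field version `exists_opNorm_fderiv_le_log` (`LocalBiotSavartLog.lean`, for
the `H³` Beale–Kato–Majda theorem) does not apply to the `C^{1,γ}` velocities of Chapter 4; the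
kernel-level `IsHolderCZKernel.norm_czDiff_le_log` (`NewtonKernelLogPotential.lean`) is for
compactly supported scalar Calderón–Zygmund kernels. Used from the tree: `fderiv_singularPotential`,
`gradPotential`, `suppCutoff*`, `norm_flip_apply_sub_le_of_holderWith`, `holderMajorant`,
`lintegral_holderMajorant` (`SingularKernelGradient`/`Truncation`), `norm_integral_cutoffTerm_le`,
`norm_fderiv_singularPotential_le_far` (`SingularKernelHolder`),
`lintegral_annulus_norm_rpow_neg_three` (`NewtonKernelLogPotential`),
`exists_isC1SingularKernel_biotSavartCLM`, `singularPotential_biotSavartCLM` (`BiotSavartGradient`),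
`exists_norm_fderiv_radialCutoff_le` (`SingularKernelTruncation`). Mathlib:
`enorm_integral_le_lintegral_enorm`, `lintegral_sub_left_eq_self`, `EuclideanSpace.volume_ball_fin_three`,
`Real.log_mul`, `Real.log_nonneg`.

## References

* A. J. Majda, A. L. Bertozzi, *Vorticity and Incompressible Flow* (CUP 2002), §4.1.3 Lemma 4.6
  (4.35) (p. 129), §4.2 (4.49)–(4.50) (p. 134–135), §4.5 proof of Lemma 4.6 (p. 143–145).
  [MajdaBertozziCUP2002]
* J. T. Beale, T. Kato, A. Majda, Comm. Math. Phys. 94 (1984), 61–66, (13)–(15).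
  [BealeKatoMajda1984]
-/

noncomputable section

open MeasureTheory Set Function Filter Metric Real
open _root_.Topology
open scoped ENNReal NNReal

namespace Literature.Analysis.FluidPDE

open NewtonPotentialHolder

/-- Local notation for physical space `ℝ³ = EuclideanSpace ℝ (Fin 3)`. -/
local notation "ℝ³" => EuclideanSpace ℝ (Fin 3)

variable {V W : Type*} [NormedAddCommGroup V] [NormedSpace ℝ V] [NormedAddCommGroup W]
  [NormedSpace ℝ W]

/-! ### The logarithmic majorant `1_{ε ≤ |z| < ρ'} |z|⁻³` -/

/-- The logarithmic majorant `1_{ε ≤ |z| < ρ'} |z|⁻³` (the bound for `∇K(x − y)(f(y) − χ(y) f(x))`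
away from the diagonal; its integral is the logarithm of (4.35)). [folklore] -/
def logMajorant (ε ρ' : ℝ) (z : ℝ³) : ℝ :=
  (ball (0 : ℝ³) ρ' \ ball 0 ε).indicator (fun z => ‖z‖ ^ (-3 : ℝ)) z

/-- The logarithmic majorant is nonnegative. [folklore] -/
theorem logMajorant_nonneg (ε ρ' : ℝ) (z : ℝ³) : 0 ≤ logMajorant ε ρ' z := by
  unfold logMajorant
  exact indicator_nonneg (fun _ _ => Real.rpow_nonneg (norm_nonneg _) _) z

/-- The logarithmic majorant is measurable. [folklore] -/
theorem measurable_logMajorant (ε ρ' : ℝ) : Measurable (logMajorant ε ρ') := by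
  unfold logMajorant
  exact Measurable.indicator (measurable_norm.pow_const _) (measurableSet_ball.diff measurableSet_ball)

/-- On the annulus the majorant is `|z|⁻³`. [folklore] -/
theorem logMajorant_eq {ε ρ' : ℝ} {z : ℝ³} (hε : ε ≤ ‖z‖) (hρ : ‖z‖ < ρ') :
    logMajorant ε ρ' z = ‖z‖ ^ (-3 : ℝ) := by
  have hz : z ∈ ball (0 : ℝ³) ρ' \ ball 0 ε := by
    simp only [Set.mem_sdiff, mem_ball, dist_zero_right, not_lt]
    exact ⟨hρ, hε⟩
  simp only [logMajorant, indicator_of_mem hz]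

/-- **The logarithm**: `∫ 1_{ε ≤ |z| < ρ'} |z|⁻³ dz = 4π log(ρ'/ε)` for `0 < ε ≤ ρ'`
(polar coordinates; the tree's `lintegral_annulus_norm_rpow_neg_three`). [cite: MajdaBertozziCUP2002, §4.5 proof of Lemma 4.6 (4.35) (p. 144)] -/
theorem lintegral_logMajorant {ε ρ' : ℝ} (hε : 0 < ε) (hερ : ε ≤ ρ') :
    ∫⁻ z, ENNReal.ofReal (logMajorant ε ρ' z) = ENNReal.ofReal (4 * π * Real.log (ρ' / ε)) := by
  have hS : MeasurableSet (ball (0 : ℝ³) ρ' \ ball 0 ε) := measurableSet_ball.diff measurableSet_ball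
  have heq : (fun z => ENNReal.ofReal (logMajorant ε ρ' z)) =
      (ball (0 : ℝ³) ρ' \ ball 0 ε).indicator (fun z => ENNReal.ofReal (‖z‖ ^ (-3 : ℝ))) := by
    funext z
    by_cases hz : z ∈ ball (0 : ℝ³) ρ' \ ball 0 ε
    · simp only [logMajorant, indicator_of_mem hz]
    · simp only [logMajorant, indicator_of_notMem hz, ENNReal.ofReal_zero]
  rw [heq, lintegral_indicator hS, lintegral_annulus_norm_rpow_neg_three hε hερ]
  congr 1
  rw [measureReal_def, EuclideanSpace.volume_ball_fin_three, ENNReal.toReal_mul,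
    ← ENNReal.ofReal_pow zero_le_one, one_pow, ENNReal.toReal_ofReal zero_le_one,
    ENNReal.toReal_ofReal (by positivity : (0 : ℝ) ≤ π * 4 / 3)]
  ring

/-! ### The two-zone majorant for the singular gradient integrand -/

section Log

variable {K : ℝ³ → V →L[ℝ] W} {A : ℝ}

/-- `(|z|³)⁻¹ = |z|⁻³` as a real power. [folklore] -/
theorem inv_pow_three_eq_rpow_neg_three (z : ℝ³) : (‖z‖ ^ 3)⁻¹ = ‖z‖ ^ (-3 : ℝ) := by
  rw [Real.rpow_neg (norm_nonneg _), show (3 : ℝ) = ((3 : ℕ) : ℝ) by norm_num, Real.rpow_natCast]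

/-- **Pointwise two-zone domination of the singular gradient integrand**
`(∇K(x−y) ·)(f y − χ y • f x)` for `x ∈ B(x₀, ρ/2)`, `supp f ⊆ B̄(x₀, ρ)`, `|f| ≤ M`, `f`
`γ`-Hölder with constant `C`, and a splitting radius `0 < ε ≤ ρ/2`: by
`A C 1_{|x−y|<ε} |x − y|^{γ−3} + 2 A M 1_{ε ≤ |x−y| < 3ρ} |x − y|⁻³` (for `|x − y| < ε` the point
`y` lies in `B̄(x₀, ρ)` where `χ = 1` and the Hölder bound applies; for `ε ≤ |x − y|` the density
difference is at most `2M` and vanishes unless `|y − x₀| < 2ρ`, where `|x − y| < 3ρ`).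
[cite: MajdaBertozziCUP2002, §4.5 proof of Lemma 4.6 (4.35) (p. 143–144)] -/
theorem norm_gradIntegrand_le_log (hK : IsC1SingularKernel K A) {γ C : ℝ≥0} {f : ℝ³ → V}
    (hf : HolderWith C γ f) {x₀ : ℝ³} {ρ M : ℝ} (hρ : 0 < ρ) (hsupp : tsupport f ⊆ closedBall x₀ ρ)
    (hM : ∀ y, ‖f y‖ ≤ M) {x : ℝ³} (hx : ‖x - x₀‖ < ρ / 2) {ε : ℝ} (hε : 0 < ε) (hερ : ε ≤ ρ / 2)
    (y : ℝ³) :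
    ‖(fderiv ℝ K (x - y)).flip (f y - suppCutoff x₀ ρ y • f x)‖ ≤
      A * C * holderMajorant γ ε (x - y) + 2 * A * M * logMajorant ε (3 * ρ) (x - y) := by
  have hA := hK.nonneg
  have hM0 : 0 ≤ M := (norm_nonneg _).trans (hM x)
  have hterm1 : 0 ≤ A * C * holderMajorant γ ε (x - y) :=
    mul_nonneg (by positivity) (holderMajorant_nonneg _ _ _)
  have hterm2 : 0 ≤ 2 * A * M * logMajorant ε (3 * ρ) (x - y) :=
    mul_nonneg (by positivity) (logMajorant_nonneg _ _ _)
  by_cases hnear : ‖x - y‖ < ε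
  · -- near the diagonal: `χ y = 1`, Hölder bound
    have hy : ‖y - x₀‖ ≤ ρ := by
      have : ‖y - x₀‖ ≤ ‖y - x‖ + ‖x - x₀‖ := norm_sub_le_norm_sub_add_norm_sub _ _ _
      rw [norm_sub_rev y x] at this
      linarith
    rw [suppCutoff_eq_one hρ hy, one_smul]
    rcases eq_or_ne x y with hxy | hxy
    · subst hxy
      simp only [sub_self, map_zero, norm_zero]
      exact add_nonneg (mul_nonneg (by positivity) (holderMajorant_nonneg _ _ _))
        (mul_nonneg (by positivity) (logMajorant_nonneg _ _ _))
    · have h := norm_flip_apply_sub_le_of_holderWith hxy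
        (hK.norm_fderiv_le _ (sub_ne_zero.2 hxy)) hf
      refine h.trans (le_add_of_le_of_nonneg ?_ hterm2)
      have hmaj : holderMajorant γ ε (x - y) = ‖x - y‖ ^ ((γ : ℝ) - 3) := by
        simp [holderMajorant, indicator, hnear]
      rw [hmaj]
  · -- away from the diagonal
    have hxyε : ε ≤ ‖x - y‖ := not_lt.1 hnear
    have hxy0 : x - y ≠ 0 := by
      intro h
      rw [h, norm_zero] at hxyε
      linarith
    by_cases hy2 : 2 * ρ ≤ ‖y - x₀‖
    · -- beyond `2ρ`: everything vanishes
      have hfy : f y = 0 := by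
        have : y ∉ tsupport f := fun h => by
          have := hsupp h
          rw [mem_closedBall, dist_eq_norm] at this
          linarith
        exact image_eq_zero_of_notMem_tsupport this
      rw [hfy, suppCutoff_eq_zero hρ hy2, zero_smul, sub_zero, map_zero, norm_zero]
      exact add_nonneg hterm1 hterm2
    · -- the annulus `ε ≤ |x − y| < 3ρ`
      have hxy3 : ‖x - y‖ < 3 * ρ := by
        have : ‖x - y‖ ≤ ‖x - x₀‖ + ‖x₀ - y‖ := norm_sub_le_norm_sub_add_norm_sub _ _ _
        rw [norm_sub_rev x₀ y] at this
        linarith [not_le.1 hy2]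
      have hmaj : logMajorant ε (3 * ρ) (x - y) = ‖x - y‖ ^ (-3 : ℝ) := logMajorant_eq hxyε hxy3
      refine le_add_of_nonneg_of_le hterm1 ?_
      rw [hmaj]
      have hdiff : ‖f y - suppCutoff x₀ ρ y • f x‖ ≤ 2 * M := by
        calc ‖f y - suppCutoff x₀ ρ y • f x‖ ≤ ‖f y‖ + ‖suppCutoff x₀ ρ y • f x‖ := norm_sub_le _ _
          _ ≤ M + 1 * M := by
              rw [norm_smul, Real.norm_eq_abs]
              exact add_le_add (hM y) (mul_le_mul (abs_suppCutoff_le_one _ _ _) (hM x)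
                (norm_nonneg _) zero_le_one)
          _ = 2 * M := by ring
      calc ‖(fderiv ℝ K (x - y)).flip (f y - suppCutoff x₀ ρ y • f x)‖
          ≤ ‖(fderiv ℝ K (x - y)).flip‖ * ‖f y - suppCutoff x₀ ρ y • f x‖ :=
            ContinuousLinearMap.le_opNorm _ _
        _ = ‖fderiv ℝ K (x - y)‖ * ‖f y - suppCutoff x₀ ρ y • f x‖ := by
            rw [ContinuousLinearMap.opNorm_flip]
        _ ≤ A * (‖x - y‖ ^ 3)⁻¹ * (2 * M) :=
            mul_le_mul (hK.norm_fderiv_le _ hxy0) hdiff (norm_nonneg _) (by positivity)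
        _ = 2 * A * M * ‖x - y‖ ^ (-3 : ℝ) := by
            rw [inv_pow_three_eq_rpow_neg_three]; ring

/-- **The logarithmic bound for the singular first term**: for `x ∈ B(x₀, ρ/2)` and
`0 < ε ≤ ρ/2`, `‖∫ (∇K(x−y)·)(f y − χ y f x) dy‖ ≤ A C 4π ε^γ/γ + 2 A M · 4π log(3ρ/ε)` (the
two-zone majorant integrated: `∫_{|z|<ε} |z|^{γ−3} = 4π ε^γ/γ`,
`∫_{ε≤|z|<3ρ} |z|⁻³ = 4π log(3ρ/ε)`). [cite: MajdaBertozziCUP2002, §4.1.3 Lemma 4.6 (4.35) (p. 129) and §4.5 (p. 143–144)] -/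
theorem norm_integral_gradIntegrand_le_log (hK : IsC1SingularKernel K A) {γ C : ℝ≥0} (hγ : 0 < γ)
    {f : ℝ³ → V} (hf : HolderWith C γ f) {x₀ : ℝ³} {ρ M : ℝ} (hρ : 0 < ρ)
    (hsupp : tsupport f ⊆ closedBall x₀ ρ) (hM : ∀ y, ‖f y‖ ≤ M) {x : ℝ³} (hx : ‖x - x₀‖ < ρ / 2)
    {ε : ℝ} (hε : 0 < ε) (hερ : ε ≤ ρ / 2) :
    ‖∫ y, (fderiv ℝ K (x - y)).flip (f y - suppCutoff x₀ ρ y • f x)‖ ≤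
      A * C * (4 * π * ε ^ (γ : ℝ) / γ) + 2 * A * M * (4 * π * Real.log (3 * ρ / ε)) := by
  have hA := hK.nonneg
  have hM0 : 0 ≤ M := (norm_nonneg _).trans (hM x)
  have hc0 : 0 ≤ A * C := by positivity
  have hc₂ : 0 ≤ 2 * A * M := by positivity
  have hε3 : ε ≤ 3 * ρ := by linarith
  have hlog0 : 0 ≤ Real.log (3 * ρ / ε) := Real.log_nonneg ((one_le_div hε).2 hε3)
  have hγ' : (0 : ℝ) < γ := by exact_mod_cast hγ
  have h1 : ‖∫ y, (fderiv ℝ K (x - y)).flip (f y - suppCutoff x₀ ρ y • f x)‖ₑ ≤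
      ENNReal.ofReal (A * C * (4 * π * ε ^ (γ : ℝ) / γ) + 2 * A * M * (4 * π * Real.log (3 * ρ / ε))) := by
    refine (enorm_integral_le_lintegral_enorm _).trans ?_
    have h2 := lintegral_mono (μ := (volume : Measure ℝ³)) fun y =>
      (show ‖(fderiv ℝ K (x - y)).flip (f y - suppCutoff x₀ ρ y • f x)‖ₑ ≤
          ENNReal.ofReal (A * C) * ENNReal.ofReal (holderMajorant γ ε (x - y)) +
            ENNReal.ofReal (2 * A * M) * ENNReal.ofReal (logMajorant ε (3 * ρ) (x - y)) from by
        rw [← ofReal_norm]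
        refine (ENNReal.ofReal_le_ofReal
          (norm_gradIntegrand_le_log hK hf hρ hsupp hM hx hε hερ y)).trans ?_
        rw [ENNReal.ofReal_add (mul_nonneg hc0 (holderMajorant_nonneg _ _ _))
            (mul_nonneg hc₂ (logMajorant_nonneg _ _ _)),
          ENNReal.ofReal_mul hc0, ENNReal.ofReal_mul hc₂])
    refine h2.trans ?_
    have hmk : Measurable fun y : ℝ³ => ENNReal.ofReal (holderMajorant γ ε (x - y)) :=
      ((measurable_holderMajorant γ ε).comp (measurable_const.sub measurable_id)).ennreal_ofReal
    have hml : Measurable fun y : ℝ³ => ENNReal.ofReal (logMajorant ε (3 * ρ) (x - y)) :=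
      ((measurable_logMajorant ε (3 * ρ)).comp (measurable_const.sub measurable_id)).ennreal_ofReal
    have hm₁ : Measurable fun y : ℝ³ =>
        ENNReal.ofReal (A * C) * ENNReal.ofReal (holderMajorant γ ε (x - y)) := hmk.const_mul _
    rw [lintegral_add_left hm₁, lintegral_const_mul _ hmk, lintegral_const_mul _ hml,
      lintegral_sub_left_eq_self (μ := (volume : Measure ℝ³))
        (fun z => ENNReal.ofReal (holderMajorant γ ε z)) x,
      lintegral_sub_left_eq_self (μ := (volume : Measure ℝ³))
        (fun z => ENNReal.ofReal (logMajorant ε (3 * ρ) z)) x,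
      lintegral_holderMajorant hγ' hε.le, lintegral_logMajorant hε hε3,
      ← ENNReal.ofReal_mul hc0, ← ENNReal.ofReal_mul hc₂,
      ← ENNReal.ofReal_add (by positivity) (by positivity)]
  rw [← ofReal_norm] at h1
  exact (ENNReal.ofReal_le_ofReal_iff (by positivity)).1 h1

/-- **Local logarithmic sup bound for the gradient** (the candidate gradient of
Gilbarg–Trudinger (4.9) on `B(x₀, ρ/2)`): for `0 < ε ≤ ρ/2`,
`‖∇v(x)‖ ≤ A C 4π ε^γ/γ + 2 A M · 4π log(3ρ/ε) + (128π/3) A B M`. [cite: MajdaBertozziCUP2002, §4.1.3 Lemma 4.6 (4.35) (p. 129)] -/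
theorem norm_gradPotential_le_log (hK : IsC1SingularKernel K A) {B : ℝ} (hB0 : 0 ≤ B)
    (hB : ∀ ε : ℝ, 0 < ε → ∀ z : ℝ³, ‖fderiv ℝ (radialCutoff ε (2 * ε)) z‖ ≤ B * ε⁻¹)
    {γ C : ℝ≥0} (hγ : 0 < γ) {f : ℝ³ → V} (hf : HolderWith C γ f) {x₀ : ℝ³} {ρ M : ℝ}
    (hρ : 0 < ρ) (hsupp : tsupport f ⊆ closedBall x₀ ρ) (hM : ∀ y, ‖f y‖ ≤ M) {x : ℝ³}
    (hx : ‖x - x₀‖ < ρ / 2) {ε : ℝ} (hε : 0 < ε) (hερ : ε ≤ ρ / 2) :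
    ‖gradPotential K x₀ ρ f x‖ ≤
      A * C * (4 * π * ε ^ (γ : ℝ) / γ) + 2 * A * M * (4 * π * Real.log (3 * ρ / ε)) +
        128 * π / 3 * A * B * M := by
  have hA := hK.nonneg
  unfold gradPotential
  refine (norm_add_le _ _).trans ?_
  have h1 := norm_integral_gradIntegrand_le_log hK hγ hf hρ hsupp hM hx hε hερ
  have h2 := (norm_integral_cutoffTerm_le hK hB0 hB hρ hx (f x)).trans
    (mul_le_mul_of_nonneg_left (hM x) (by positivity))
  linarith

/-- **Global logarithmic sup bound for the gradient of the singular potential of a Hölder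
density** (Majda–Bertozzi Lemma 4.6 **(4.35)**: "`|P_N f|_0 ≤ c{|f|_γ ε^γ + max(1, ln(R/ε))|f|_0}`
for all `ε > 0`", here for `0 < ε ≤ R`, together with (4.49) `∇(K f) = P f + c f`): if `f` is
`γ`-Hölder with constant `C`, `supp f ⊆ B̄(x₀, R)` and `|f| ≤ M`, then for every `x`,
`‖∇v(x)‖ ≤ A C 4π ε^γ/γ + 8π A M (log(R/ε) + log 12) + (4π/3) A M + (128π/3) A B M`
(near the support, `|x − x₀| < 2R`, this is `norm_gradPotential_le_log` with `ρ = 4R`, where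
`log(3ρ/ε) = log 12 + log(R/ε)`; far away, `norm_fderiv_singularPotential_le_far`). [cite: MajdaBertozziCUP2002, §4.1.3 Lemma 4.6 (4.35) (p. 129) and §4.2 (4.49)–(4.50) (p. 134–135)] -/
theorem norm_fderiv_singularPotential_le_log (hK : IsC1SingularKernel K A) {B : ℝ} (hB0 : 0 ≤ B)
    (hB : ∀ ε : ℝ, 0 < ε → ∀ z : ℝ³, ‖fderiv ℝ (radialCutoff ε (2 * ε)) z‖ ≤ B * ε⁻¹)
    {γ C : ℝ≥0} (hγ : 0 < γ) {f : ℝ³ → V} (hf : HolderWith C γ f) {x₀ : ℝ³} {R M : ℝ}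
    (hR : 0 < R) (hsupp : tsupport f ⊆ closedBall x₀ R) (hM : ∀ y, ‖f y‖ ≤ M) {ε : ℝ}
    (hε : 0 < ε) (hεR : ε ≤ R) (x : ℝ³) :
    ‖fderiv ℝ (singularPotential K f) x‖ ≤
      A * C * (4 * π * ε ^ (γ : ℝ) / γ) + 8 * π * A * M * (Real.log (R / ε) + Real.log 12) +
        4 / 3 * π * A * M + 128 * π / 3 * A * B * M := by
  have hA := hK.nonneg
  have hM0 : 0 ≤ M := (norm_nonneg _).trans (hM x)
  have hlog0 : 0 ≤ Real.log (R / ε) := Real.log_nonneg ((one_le_div hε).2 hεR)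
  have hlog12 : 0 ≤ Real.log 12 := Real.log_nonneg (by norm_num)
  have h1 : 0 ≤ A * C * (4 * π * ε ^ (γ : ℝ) / γ) := by positivity
  have h2 : 0 ≤ 8 * π * A * M * (Real.log (R / ε) + Real.log 12) := by positivity
  have h3 : 0 ≤ 4 / 3 * π * A * M := by positivity
  have h4 : 0 ≤ 128 * π / 3 * A * B * M := by positivity
  by_cases hx : ‖x - x₀‖ < 2 * R
  · have hρ : (0 : ℝ) < 4 * R := by positivity
    have hxρ : ‖x - x₀‖ < 4 * R / 2 := by linarith
    have hsupp' : tsupport f ⊆ closedBall x₀ (4 * R) :=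
      hsupp.trans (closedBall_subset_closedBall (by linarith))
    have hερ : ε ≤ 4 * R / 2 := by linarith
    rw [fderiv_singularPotential hK hγ hf hρ hsupp' hxρ]
    have h := norm_gradPotential_le_log hK hB0 hB hγ hf hρ hsupp' hM hxρ hε hερ
    have hlog : Real.log (3 * (4 * R) / ε) = Real.log (R / ε) + Real.log 12 := by
      rw [show 3 * (4 * R) / ε = 12 * (R / ε) by ring,
        Real.log_mul (by norm_num) (div_pos hR hε).ne', add_comm]
    rw [hlog] at h
    linarith
  · have h := norm_fderiv_singularPotential_le_far hK hγ hf hR hsupp hM (not_lt.1 hx)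
    linarith

end Log

/-! ### The Biot–Savart law -/

/-- **Logarithmic sup bound for the velocity gradient of the Biot–Savart law** (Majda–Bertozzi
(4.35) with (4.49), the input of (4.50)): there is `c = c(γ) ≥ 0` such that for every
`γ`-Hölder vorticity `ω` with constant `C`, supported in `B̄(x₀, R)` and bounded by `M`, and
every `0 < ε ≤ R`, `‖∇(K₃ ∗ ω)(x)‖ ≤ c (C ε^γ + M (1 + log(R/ε)))` for all `x`. [cite: MajdaBertozziCUP2002, §4.1.3 Lemma 4.6 (4.35) (p. 129) and §4.2 (4.49)–(4.50) (p. 134–135)] -/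
theorem exists_norm_fderiv_biotSavart_le_log {γ : ℝ≥0} (hγ : 0 < γ) :
    ∃ c : ℝ, 0 ≤ c ∧ ∀ (ω : ℝ³ → ℝ³) (C : ℝ≥0) (x₀ : ℝ³) (R M ε : ℝ), 0 < R → HolderWith C γ ω →
      tsupport ω ⊆ closedBall x₀ R → (∀ y, ‖ω y‖ ≤ M) → 0 < ε → ε ≤ R →
        ∀ x, ‖fderiv ℝ (biotSavart ω) x‖ ≤ c * (C * ε ^ (γ : ℝ) + M * (1 + Real.log (R / ε))) := by
  obtain ⟨A, hA⟩ := exists_isC1SingularKernel_biotSavartCLM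
  obtain ⟨B, hB0, hB⟩ := exists_norm_fderiv_radialCutoff_le
  have hA0 := hA.nonneg
  have hγ' : (0 : ℝ) < γ := by exact_mod_cast hγ
  have hlog12 : 0 ≤ Real.log 12 := Real.log_nonneg (by norm_num)
  set c : ℝ := max (A * (4 * π / γ))
    (max (8 * π * A) (8 * π * A * Real.log 12 + 4 / 3 * π * A + 128 * π / 3 * A * B)) with hc
  have hc1 : A * (4 * π / γ) ≤ c := le_max_left _ _
  have hc2 : 8 * π * A ≤ c := (le_max_left _ _).trans (le_max_right _ _)
  have hc3 : 8 * π * A * Real.log 12 + 4 / 3 * π * A + 128 * π / 3 * A * B ≤ c :=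
    (le_max_right _ _).trans (le_max_right _ _)
  refine ⟨c, le_max_of_le_left (by positivity), fun ω C x₀ R M ε hR hω hsupp hM hε hεR x => ?_⟩
  have hM0 : 0 ≤ M := (norm_nonneg _).trans (hM x)
  have hlog0 : 0 ≤ Real.log (R / ε) := Real.log_nonneg ((one_le_div hε).2 hεR)
  have h := norm_fderiv_singularPotential_le_log hA hB0 hB hγ hω hR hsupp hM hε hεR x
  rw [singularPotential_biotSavartCLM] at h
  refine h.trans ?_
  have hεγ : 0 ≤ ε ^ (γ : ℝ) := by positivity
  calc A * C * (4 * π * ε ^ (γ : ℝ) / γ) + 8 * π * A * M * (Real.log (R / ε) + Real.log 12) +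
        4 / 3 * π * A * M + 128 * π / 3 * A * B * M
      = (A * (4 * π / γ)) * (C * ε ^ (γ : ℝ)) + (8 * π * A) * (M * Real.log (R / ε)) +
          (8 * π * A * Real.log 12 + 4 / 3 * π * A + 128 * π / 3 * A * B) * M := by ring
    _ ≤ c * (C * ε ^ (γ : ℝ)) + c * (M * Real.log (R / ε)) + c * M := by
        gcongr
    _ = c * (C * ε ^ (γ : ℝ) + M * (1 + Real.log (R / ε))) := by ring

end Literature.Analysis.FluidPDE
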